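/-
COR-CM (cell pub-hodgecm2, stage 2 of the Hodge ladder) — count-neutral KERNEL CENSUS TRANSPORT «the MARKMAN COLUMN», degree 12, type
`ℤ/6×ℤ/2` (`c = (3,0)`) — CLOSED automorphism form on Markman's fourfold theorem (seat prover-pub-hodgecm2-b23-g34-0, binder prover b23, gen 34; own lane DEG12-MARKMAN-TRANSPORT,
HOME/LIT-CLAIMS.md l.1451, HOME/INBOX.md l.5632; seat b07's ORBIT-COUNT v2 §7.3/§7.4 offer by adjacency; sequel of
`Census/DuodecicFaceTransportC6C2.lean` (b23) on seat b09's DECIC-MARKMAN pattern `Census/DecicFaceTransportOfMarkman.lean`, generic part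
`CorCM/FaceCensusMarkmanColumn.lean`).  Theorems only; no definition, no named fact, nothing asserted; the census data `Γ` of
`Census/DuodecicFaceGeneratorsC6C2.lean` BY NAME; `Interfaces.lean` (C1), every E term, `B01/*`, `Transposition/*` untouched.
HONEST FRAMING (COORDINATOR RULING — HODGE FRAMING CORRECTION, 2026-08-21T11:55:35Z): `HC_CM` is NOT proved, here or anywhere in the
tree; nothing here produces a period or proves a case of the Hodge conjecture.
T5 (coordinator ruling 15:33:56Z (3)): binder set of the headline = b23's landed `…_duodecicC6C2_aut` set {dictionary (σ₀, ε, hε, c, hc, hεc), face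
descriptions, face periods} MINUS 1 face period(s) PLUS {`Markman2025_weilClasses_algebraic_abelianFourfold` (the cell's standing named fact,
E. Markman, UNREFEREED)}; the type data and `hHC` binders of the GalT-form transport are DISCHARGED here by seat b09's
`DuodecicMarkmanFamilies.exists_families_c6c2` (consumed BY NAME); no `¬` theorem in the tree against any binder; no contradiction derivable;
checker: self (prover-pub-hodgecm2-b23-g34-0), 2026-08-21.
-/
import Summits.HodgeConjecture.CorCM.Census.DuodecicFaceTransportC6C2OfMarkman
import Summits.HodgeConjecture.CorCM.DuodecicMarkmanFamilies
import HarnessLib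

/-!
# Degree 12, type `ℤ/6×ℤ/2` (`c = (3,0)`): 5 face periods + Markman's FOURFOLD theorem close the slice (automorphism form, CLOSED)

The last file of the lane: composition BY NAME of the census transport with the Markman column
(`Census/DuodecicFaceTransportC6C2OfMarkman.lean`: 5 face periods + `HodgeConjectureFor` of 1 tree product(s) `cmProdAV K h₃ 1 ![E, T]` for
code-read types) with seat b09's `CorCM/DuodecicMarkmanFamilies.lean` (`DuodecicMarkmanFamilies.exists_families_c6c2`: under the automorphism
dictionary the code-read types EXIST and those products satisfy the Hodge conjecture GIVEN ONLY `Markman2025_weilClasses_algebraic_abelianFourfold`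
— `E = Ψ^K`, `T = Φ^K` for types of the subfields `K^H` read off the codes, seat b09's `CorCM/FaceCensusInducedTypes.lean`, and seat b07's
`InducedCurveThreefold.hodgeConjectureFor_cmProdAV_inducedCMType_pair_of_markman`).  The families:

* `![E₀, T₁]` reading `(1365, 3640)` — the type of `K` induced from the type `{σ₀|_{k₀}}` of the imaginary quadratic subfield `k₀ = K^{2ℤ/6 × ℤ/2}` (mask `1365` = `Gal(K/k₀) = {0,2,4,6,8,10}`, indices `i ↔ (i % 6, i / 6)`); induced from the CYCLIC sextic CM subfield `L₀ = K^{⟨(0,1)⟩}` (cosets `{(a,0),(a,1)}`, `a ∈ {3,4,5}`, mask `3640`; a threefold type NOT induced from `k₀ ⊂ L₀`)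

HEADLINES: `…_duodecicC6C2_of_markman_aut` — for a Galois CM field `K` with the AUTOMORPHISM dictionary of this type (`σ₀`,
`ε : Aut(K) ≃ Fin 12` multiplicative for b30's table, `c` the conjugation at `σ₀` with `ε c = 3`) and 5 faces described through `ε` as
`(455;9,18)`, `(455;9,36)`, `(455;9,1152)`, `(462;18,2304)`, `(462;36,1152)`:

  ONE period witness on each of these 5 faces ∧ Markman's fourfold theorem
    ⟹ the Hodge conjecture, in every codimension, for every complex abelian variety dominated by a finite product of abelian varieties
      realising CM types of CM fields embeddable in `K`;

and, in `Census/DuodecicFaceTransportC6C2OfMarkmanMulEquiv.lean`, `…_duodecicC6C2_of_markman_mulEquiv` — the same from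
`e : Gal(K/ℚ) ≃* Multiplicative (ZMod 6 × ZMod 2)` (seat b23 gen 33's intrinsic dictionary).  Seat b23's landed `…_duodecicC6C2_aut` / `…_mulEquiv` need 6 face periods and no named fact.  `HC_CM` is NOT proved; no period is produced here.

References: [cite: Markman2025SurveySecant, Thm. 1.2]; [cite: Pohlmann1968, Thm. 1]; [cite: Milne1999LefschetzClasses, Thm. 3.2 and Cor. 4.5];
[cite: Shimura1998, §6.2 Theorem 3, §6.1 Corollary of Theorem 2 (pp. 41–43), §8.2 Prop. 26]; [cite: MumfordAV1970, §19 Thm. 1 and p. 169].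
-/

noncomputable section

open CategoryTheory NumberField NumberField.ComplexEmbedding
open Literature.AlgebraicGeometry Literature.AlgebraicGeometry.Motives Literature.AlgebraicGeometry.HodgeTheory
open Literature.AlgebraicGeometry.ComplexMultiplication Literature.AlgebraicGeometry.Milne1999
open Literature.NumberTheory.Automorphic Literature.NumberTheory.Automorphic.PicardCM
open Literature.NumberTheory.ComplexMultiplication.CMTypeOps
open Summit.HodgeConjecture.CorCM.Prior.AllgGroup.RfwfAllgGroup
open Summit.HodgeConjecture.CorCM.Census.FaceSquaresModel
open Summit.HodgeConjecture.CorCM.Census.DuodecicFaceGeneratorsC6C2 (Γ)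
open Summit.HodgeConjecture.CorCM.FaceCensus
open Summit.HodgeConjecture.CorCM.Domination

namespace Summit.HodgeConjecture.CorCM.DuodecicFaceTransport.C6C2Markman

/-- **FIELD CLOSURE, type `ℤ/6×ℤ/2` (`c = (3,0)`) — 5 face periods + Markman's fourfold theorem, from AUTOMORPHISM data (CLOSED headline).**
`K` a Galois CM field, `σ₀` a base embedding, `ε : Aut(K) ≃ Fin 12` multiplicative for b30's table, `c` the automorphism inducing complex
conjugation at `σ₀` with `ε c = 3`; faces `R₁`, `R₂`, `R₃`, `R₄`, `R₅` of `K` described through `ε` as `(455;9,18)`, `(455;9,36)`, `(455;9,1152)`, `(462;18,2304)`, `(462;36,1152)`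
(`σ₀ ∘ g ∈ Rᵢ.Φ ↔ ε g ∈` type mask; place representatives `σ₀ ∘ g_p`, `σ₀ ∘ g_q` with the listed place masks).  ONE period witness for each of
these 5 faces on the universe of record together with Markman's fourfold theorem implies the Hodge conjecture, in every codimension, for
every complex abelian variety dominated by a finite product of abelian varieties realising CM types of CM fields embeddable in `K`.  NO other
hypothesis: the code-read types and their Markman inputs come from `DuodecicMarkmanFamilies.exists_families_c6c2` (seat b09).  (FRAMING: conditional on
these 5 face periods — instances of the crux — and on Markman's UNREFEREED theorem; seat b23's `…_duodecicC6C2_aut` needs 6 periods;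
`HC_CM` is not proved.) [cite: Markman2025SurveySecant, Thm. 1.2] [cite: Shimura1998, §6.2 Theorem 3 and §6.1 Corollary of Theorem 2 (pp. 41–43)]
[cite: Pohlmann1968, Thm. 1] [cite: Milne1999LefschetzClasses, Thm. 3.2 and Cor. 4.5] [cite: MumfordAV1970, §19 Thm. 1 and p. 169] -/
theorem hodgeConjectureFor_of_avDominatedBy_isProductOf_of_facePeriods_duodecicC6C2_of_markman_aut
    (hW4 : Markman2025_weilClasses_algebraic_abelianFourfold) (K : CMField) [IsGalois ℚ K]
    (σ₀ : (K : Type) →+* ℂ) (ε : ((K : Type) ≃ₐ[ℚ] (K : Type)) ≃ Fin 12) (hε : ∀ g h : ((K : Type) ≃ₐ[ℚ] (K : Type)), ε (g * h) = Γ.mul (ε g) (ε h))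
    (c : ((K : Type) ≃ₐ[ℚ] (K : Type))) (hc : σ₀.comp (c : (K : Type) →+* (K : Type)) = conjugate σ₀) (hεc : ε c = Γ.conj)
    (R₁ R₂ R₃ R₄ R₅ : Face K) (g₁ g₁' : ((K : Type) ≃ₐ[ℚ] (K : Type))) (g₂ g₂' : ((K : Type) ≃ₐ[ℚ] (K : Type))) (g₃ g₃' : ((K : Type) ≃ₐ[ℚ] (K : Type))) (g₄ g₄' : ((K : Type) ≃ₐ[ℚ] (K : Type))) (g₅ g₅' : ((K : Type) ≃ₐ[ℚ] (K : Type)))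
    (hΦ₁ : ∀ g : ((K : Type) ≃ₐ[ℚ] (K : Type)),
      σ₀.comp (g : (K : Type) →+* (K : Type)) ∈ R₁.Φ.1 ↔ mem (ε g) 455 = true)
    (hp₁ : R₁.p = σ₀.comp (g₁ : (K : Type) →+* (K : Type))) (hp₁' : Γ.placeMask (ε g₁) = 9)
    (hq₁ : R₁.p' = σ₀.comp (g₁' : (K : Type) →+* (K : Type))) (hq₁' : Γ.placeMask (ε g₁') = 18)
    (hΦ₂ : ∀ g : ((K : Type) ≃ₐ[ℚ] (K : Type)),
      σ₀.comp (g : (K : Type) →+* (K : Type)) ∈ R₂.Φ.1 ↔ mem (ε g) 455 = true)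
    (hp₂ : R₂.p = σ₀.comp (g₂ : (K : Type) →+* (K : Type))) (hp₂' : Γ.placeMask (ε g₂) = 9)
    (hq₂ : R₂.p' = σ₀.comp (g₂' : (K : Type) →+* (K : Type))) (hq₂' : Γ.placeMask (ε g₂') = 36)
    (hΦ₃ : ∀ g : ((K : Type) ≃ₐ[ℚ] (K : Type)),
      σ₀.comp (g : (K : Type) →+* (K : Type)) ∈ R₃.Φ.1 ↔ mem (ε g) 455 = true)
    (hp₃ : R₃.p = σ₀.comp (g₃ : (K : Type) →+* (K : Type))) (hp₃' : Γ.placeMask (ε g₃) = 9)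
    (hq₃ : R₃.p' = σ₀.comp (g₃' : (K : Type) →+* (K : Type))) (hq₃' : Γ.placeMask (ε g₃') = 1152)
    (hΦ₄ : ∀ g : ((K : Type) ≃ₐ[ℚ] (K : Type)),
      σ₀.comp (g : (K : Type) →+* (K : Type)) ∈ R₄.Φ.1 ↔ mem (ε g) 462 = true)
    (hp₄ : R₄.p = σ₀.comp (g₄ : (K : Type) →+* (K : Type))) (hp₄' : Γ.placeMask (ε g₄) = 18)
    (hq₄ : R₄.p' = σ₀.comp (g₄' : (K : Type) →+* (K : Type))) (hq₄' : Γ.placeMask (ε g₄') = 2304)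
    (hΦ₅ : ∀ g : ((K : Type) ≃ₐ[ℚ] (K : Type)),
      σ₀.comp (g : (K : Type) →+* (K : Type)) ∈ R₅.Φ.1 ↔ mem (ε g) 462 = true)
    (hp₅ : R₅.p = σ₀.comp (g₅ : (K : Type) →+* (K : Type))) (hp₅' : Γ.placeMask (ε g₅) = 36)
    (hq₅ : R₅.p' = σ₀.comp (g₅' : (K : Type) →+* (K : Type))) (hq₅' : Γ.placeMask (ε g₅') = 1152)
    (h₁ : ∃ ι₁ : K →+* ℂ, R₁.Admissible ι₁ ∧ ∃ (V : HermSpace3 K ι₁) (σ : K →+* ℂ),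
      (Model.picardCMUniverse exists_isReal_hodgeModel_holds hodgePQ_independent_of_hodgeModel_holds
        BallQuotient.ballQuotientUniformised_holds cmAbelianVarietyRealised_holds).PeriodNV ι₁ V K R₁.psi σ)
    (h₂ : ∃ ι₁ : K →+* ℂ, R₂.Admissible ι₁ ∧ ∃ (V : HermSpace3 K ι₁) (σ : K →+* ℂ),
      (Model.picardCMUniverse exists_isReal_hodgeModel_holds hodgePQ_independent_of_hodgeModel_holds
        BallQuotient.ballQuotientUniformised_holds cmAbelianVarietyRealised_holds).PeriodNV ι₁ V K R₂.psi σ)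
    (h₃ : ∃ ι₁ : K →+* ℂ, R₃.Admissible ι₁ ∧ ∃ (V : HermSpace3 K ι₁) (σ : K →+* ℂ),
      (Model.picardCMUniverse exists_isReal_hodgeModel_holds hodgePQ_independent_of_hodgeModel_holds
        BallQuotient.ballQuotientUniformised_holds cmAbelianVarietyRealised_holds).PeriodNV ι₁ V K R₃.psi σ)
    (h₄ : ∃ ι₁ : K →+* ℂ, R₄.Admissible ι₁ ∧ ∃ (V : HermSpace3 K ι₁) (σ : K →+* ℂ),
      (Model.picardCMUniverse exists_isReal_hodgeModel_holds hodgePQ_independent_of_hodgeModel_holds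
        BallQuotient.ballQuotientUniformised_holds cmAbelianVarietyRealised_holds).PeriodNV ι₁ V K R₄.psi σ)
    (h₅ : ∃ ι₁ : K →+* ℂ, R₅.Admissible ι₁ ∧ ∃ (V : HermSpace3 K ι₁) (σ : K →+* ℂ),
      (Model.picardCMUniverse exists_isReal_hodgeModel_holds hodgePQ_independent_of_hodgeModel_holds
        BallQuotient.ballQuotientUniformised_holds cmAbelianVarietyRealised_holds).PeriodNV ι₁ V K R₅.psi σ)
    {P A : AbelianVariety ℂ} (hP : AbelianVariety.IsProductOf (fun B : AbelianVariety ℂ =>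
      ∃ (E : Type) (_ : Field E) (_ : NumberField E) (_ : IsCMField E) (_ : E →+* (K : Type)) (Φ : CMType E)
        (ι : 𝓞 E →+* End B) (θ : E →+* Module.End ℂ (complexBetti B.X 1)),
        IsCMTypeRealisation Φ B ι θ) P)
    (hA : AVDominatedBy A P) : HodgeConjectureFor A.dim A.X := by
  obtain ⟨e, hmul, he⟩ := exists_enum_of_autEnum Γ σ₀ ε hε
  have hconj : e conjT = Γ.conj := by rw [conjT_eq_translate σ₀, ← hc, he, hεc]
  obtain ⟨E₀, T₁, hE₀, hT₁, hHC₁⟩ :=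
    DuodecicMarkmanFamilies.exists_families_c6c2 hW4 σ₀ ε hε c hc hεc
  exact hodgeConjectureFor_of_avDominatedBy_isProductOf_of_facePeriods_of_hodgeConjectureFor_duodecicC6C2 K e hmul hconj σ₀ R₁ R₂ R₃ R₄ R₅
    (reads_of_autEnum Γ e σ₀ ε he R₁ hΦ₁ hp₁ hp₁' hq₁ hq₁')
    (reads_of_autEnum Γ e σ₀ ε he R₂ hΦ₂ hp₂ hp₂' hq₂ hq₂')
    (reads_of_autEnum Γ e σ₀ ε he R₃ hΦ₃ hp₃ hp₃' hq₃ hq₃')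
    (reads_of_autEnum Γ e σ₀ ε he R₄ hΦ₄ hp₄ hp₄' hq₄ hq₄')
    (reads_of_autEnum Γ e σ₀ ε he R₅ hΦ₅ hp₅ hp₅' hq₅ hq₅')
    E₀ T₁
    (reads_galT_of_reads_aut ε σ₀ he hE₀)
    (reads_galT_of_reads_aut ε σ₀ he hT₁)
    hHC₁
    h₁ h₂ h₃ h₄ h₅ hP hA

end Summit.HodgeConjecture.CorCM.DuodecicFaceTransport.C6C2Markman

end
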